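import Literature.ModelTheory.Zilber.EACAperiodicBase
import Literature.ModelTheory.Zilber.EACMonomialChange
import Literature.ModelTheory.Zilber.EACLatticeLemmas
import HarnessLib

/-!
# The periodic sub-cell of `EC(d+1, d)`: the integer period may be normalised to `e_last`

Following the `n = 2` dichotomy of Mantova–Masser 2024 (is the base curve a line of rational slope
or not), the tree splits the next open cell `EC(3,2)` of Zilber's Exponential-Algebraic Closedness
conjecture by whether the additive base `B = cl π(W ∩ Gⁿ)` (a hypersurface of `ℂⁿ`, `n = d + 1`)
has a nonzero integer period: `ECCell (d+1) d ↔ ECCellAperiodic d ∧ ECCellPeriodic d`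
(`EACAperiodicBase`).  This file proves the standard first reduction of the PERIODIC sub-cell: by a
lattice change `Φ_U`, `U ∈ GLₙ(ℤ)` — which preserves every binder of the cell
(`cell_hypotheses_latticeClosure`, `EACMonomialChange`) — and unimodular completion of a primitive
vector (`EACLatticeLemmas`), the period `v = g · v'` (`v'` primitive; and a period `g · v'` gives
the period `v'`, `period_of_period_zsmul` — the closure of the base is a cylinder) is moved to
EXACTLY `e_last`.  Hence

* `ecCellPeriodic_iff_std : ECCellPeriodic d ↔ ECCellPeriodicStd d`, where `ECCellPeriodicStd d`
  asks for `Γ_exp`-points only on those `W` whose base `B` has the period `e_last`, i.e.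
  (`isPeriodVec_iff_line`, `mem_zeroLocus_vanishingIdeal_update_last_iff`) membership in `cl B`
  does not depend on the last coordinate: `cl B` is a cylinder `B₀ × ℂ`;
* `ecCellPeriodicStd_iff_fib_and_dom`: the normalised sub-cell splits further by
  `dim [Δ_d](W ∩ Gⁿ) ∈ {d, d+1}`, `Δ_d = diag(1,…,1,0)` (§FibrationSplit), and
  `ecCell_three_two_iff_three : ECCell 3 2 ↔ ECCellAperiodic 2 ∧ ECCellPeriodicStdFib 2 ∧
  ECCellPeriodicStdDom 2`.

No case of the conjecture is proved here; `EC(3,2)` and all three pieces remain OPEN.  These are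
reductions of the open statement, typed sorry-free; they are not Schanuel's conjecture and do not
bear on it. [cite: MantovaMasser2023]
-/

namespace Literature.ModelTheory.Zilber

open Literature.NumberTheory.Transcendental MvPolynomial Matrix

variable {F : Type*} [Field F] {n : ℕ}

/-! ## Period vectors and their transport under `x ↦ U x` -/

/-- `v ∈ ℤⁿ` is a period vector of (the Zariski closure of) `B ⊆ Fⁿ`: `I(B)` is stable under
`p ↦ p(X + v)`.  `HasIntegerPeriod F B ↔ ∃ v ≠ 0, IsPeriodVec F B v` by definition. [folklore] -/
def IsPeriodVec (F : Type*) [Field F] {n : ℕ} (B : Set (Fin n → F)) (v : Fin n → ℤ) : Prop :=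
  ∀ p ∈ vanishingIdeal F B, transl (fun i => (v i : F)) p ∈ vanishingIdeal F B

/-- `HasIntegerPeriod` unfolded through `IsPeriodVec`. [folklore] -/
theorem hasIntegerPeriod_iff_exists_isPeriodVec (B : Set (Fin n → F)) :
    HasIntegerPeriod F B ↔ ∃ v : Fin n → ℤ, v ≠ 0 ∧ IsPeriodVec F B v :=
  Iff.rfl

/-- Point reading: `v` is a period vector iff `cl B + v ⊆ cl B`. [folklore] -/
theorem isPeriodVec_iff (B : Set (Fin n → F)) (v : Fin n → ℤ) :
    IsPeriodVec F B v ↔ ∀ x ∈ zeroLocus F (vanishingIdeal F B),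
      x + (fun i => (v i : F)) ∈ zeroLocus F (vanishingIdeal F B) :=
  forall_transl_mem_vanishingIdeal_iff B _

/-- **The Zariski closure commutes with `x ↦ U x`** (inverse pair):
`Z(I(U · S)) = U · Z(I(S))`. [folklore] -/
theorem zeroLocus_vanishingIdeal_image_intLinMap {U V : Matrix (Fin n) (Fin n) ℤ}
    (hUV : U * V = 1) (hVU : V * U = 1) (S : Set (Fin n → F)) :
    zeroLocus F (vanishingIdeal F (intLinMap U '' S)) =
      intLinMap U '' zeroLocus F (vanishingIdeal F S) := by
  ext y
  constructor
  · intro hy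
    refine ⟨intLinMap V y, ?_, intLinMap_intLinMap_of_mul_eq_one hUV y⟩
    rw [mem_zeroLocus_iff]
    intro q hq
    have hp : linSubst V q ∈ vanishingIdeal F (intLinMap U '' S) := by
      rw [vanishingIdeal_image_intLinMap, Ideal.mem_comap, ← AlgHom.comp_apply, linSubst_comp,
        hVU, linSubst_one]
      exact hq
    have h0 := (mem_zeroLocus_iff.1 hy) _ hp
    rwa [aeval_linSubst] at h0
  · rintro ⟨x, hx, rfl⟩
    rw [mem_zeroLocus_iff]
    intro p hp
    rw [vanishingIdeal_image_intLinMap, Ideal.mem_comap] at hp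
    have h0 := (mem_zeroLocus_iff.1 hx) _ hp
    rwa [aeval_linSubst] at h0

/-- **Period vectors transport**: if `v` is a period vector of `B` then `U v` is one of `U · B`
(inverse pair). [folklore] -/
theorem isPeriodVec_image_intLinMap {U V : Matrix (Fin n) (Fin n) ℤ} (hUV : U * V = 1)
    (hVU : V * U = 1) {B : Set (Fin n → F)} {v : Fin n → ℤ} (hv : IsPeriodVec F B v) :
    IsPeriodVec F (intLinMap U '' B) (U *ᵥ v) := by
  rw [isPeriodVec_iff] at hv ⊢
  rw [zeroLocus_vanishingIdeal_image_intLinMap hUV hVU]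
  rintro _ ⟨x, hx, rfl⟩
  refine ⟨x + fun i => (v i : F), hv x hx, ?_⟩
  rw [intLinMap_add, intLinMap_intCast]

/-- `U v ≠ 0` for `v ≠ 0` (inverse pair). [folklore] -/
theorem mulVec_ne_zero_of_mul_eq_one {U V : Matrix (Fin n) (Fin n) ℤ} (hVU : V * U = 1)
    {v : Fin n → ℤ} (hv : v ≠ 0) : U *ᵥ v ≠ 0 := by
  intro h
  apply hv
  have : V *ᵥ (U *ᵥ v) = v := by rw [Matrix.mulVec_mulVec, hVU, Matrix.one_mulVec]
  rw [← this, h, Matrix.mulVec_zero]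

/-- **`HasIntegerPeriod` transports** under `x ↦ U x` (inverse pair). [folklore] -/
theorem hasIntegerPeriod_image_intLinMap {U V : Matrix (Fin n) (Fin n) ℤ} (hUV : U * V = 1)
    (hVU : V * U = 1) {B : Set (Fin n → F)} (h : HasIntegerPeriod F B) :
    HasIntegerPeriod F (intLinMap U '' B) := by
  obtain ⟨v, hv0, hv⟩ := h
  exact ⟨U *ᵥ v, mulVec_ne_zero_of_mul_eq_one hVU hv0, isPeriodVec_image_intLinMap hUV hVU hv⟩

/-- … and back: `HasIntegerPeriod (U · B) ↔ HasIntegerPeriod B`. [folklore] -/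
theorem hasIntegerPeriod_image_intLinMap_iff {U V : Matrix (Fin n) (Fin n) ℤ} (hUV : U * V = 1)
    (hVU : V * U = 1) (B : Set (Fin n → F)) :
    HasIntegerPeriod F (intLinMap U '' B) ↔ HasIntegerPeriod F B := by
  refine ⟨fun h => ?_, hasIntegerPeriod_image_intLinMap hUV hVU⟩
  have h' := hasIntegerPeriod_image_intLinMap hVU hUV h
  rwa [Set.image_image, show (fun x => intLinMap V (intLinMap U x)) = id from
    funext fun x => intLinMap_intLinMap_of_mul_eq_one hVU x, Set.image_id] at h'

/-! ## The normalised periodic sub-cell -/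

/-- **The periodic sub-cell of `EC(d+1, d)` with normalised period**: as `ECCellPeriodic d`, but
the base is only assumed to have THE period `e_last` (the last standard basis vector), i.e.
its closure is a cylinder over the last coordinate (`isPeriodVec_iff_line`).  OPEN (equivalent to
`ECCellPeriodic d`, `ecCellPeriodic_iff_std`). [cite: MantovaMasser2023] -/
def ECCellPeriodicStd (d : ℕ) : Prop :=
  ∀ (W : Set (Fin (d + 1) ⊕ Fin (d + 1) → ℂ)), IsIrreducibleClosed ℂ W →
    (W ∩ torusLocus ℂ (d + 1)).Nonempty → IsRotund ℂ (d + 1) (W ∩ torusLocus ℂ (d + 1)) →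
    IsAddFree ℂ (d + 1) (W ∩ torusLocus ℂ (d + 1)) → IsMulFree ℂ (d + 1) (W ∩ torusLocus ℂ (d + 1)) →
    zariskiDim ℂ W = (d + 1 : ℕ) → addProjDim ℂ (d + 1) W = d →
    IsPeriodVec ℂ (projAdd '' (W ∩ torusLocus ℂ (d + 1))) (Pi.single (Fin.last d) 1) →
    (W ∩ expGraph ℂ (d + 1)).Nonempty

/-- `e_last ≠ 0`. [folklore] -/
theorem single_last_ne_zero (d : ℕ) : (Pi.single (Fin.last d) (1 : ℤ) : Fin (d + 1) → ℤ) ≠ 0 := by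
  intro h
  have := congr_fun h (Fin.last d)
  simp at this

/-- **A period vector makes the closure a cylinder** (characteristic zero): if `v` is a period
vector of `B` then `cl B + t·v ⊆ cl B` for every scalar `t` (tree: `forall_transl_smul_mem_of_period`).
[folklore] -/
theorem isPeriodVec_iff_line {F : Type*} [Field F] [CharZero F] {n : ℕ} (B : Set (Fin n → F))
    (v : Fin n → ℤ) :
    IsPeriodVec F B v ↔ ∀ t : F, ∀ x ∈ zeroLocus F (vanishingIdeal F B),
      (x + t • fun i => (v i : F)) ∈ zeroLocus F (vanishingIdeal F B) := by
  constructor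
  · intro h t
    exact (forall_transl_mem_vanishingIdeal_iff B _).1 (forall_transl_smul_mem_of_period h t)
  · intro h
    rw [isPeriodVec_iff]
    simpa only [one_smul] using h 1

/-- The integer vector `e_last`, cast to `F`, is `Pi.single (Fin.last d) 1`. [folklore] -/
theorem intCast_single_last {F : Type*} [Field F] (d : ℕ) :
    (fun i => ((Pi.single (Fin.last d) (1 : ℤ) : Fin (d + 1) → ℤ) i : F)) =
      Pi.single (Fin.last d) (1 : F) := by
  funext i
  rw [Pi.apply_single (fun _ => (Int.cast : ℤ → F)) (fun _ => Int.cast_zero) (Fin.last d) (1 : ℤ) i,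
    Int.cast_one]

/-- Changing the last coordinate is a translation along `e_last`. [folklore] -/
theorem update_last_eq_add_smul {F : Type*} [Field F] {d : ℕ} (x : Fin (d + 1) → F) (t : F) :
    Function.update x (Fin.last d) t =
      x + (t - x (Fin.last d)) • (Pi.single (Fin.last d) (1 : F) : Fin (d + 1) → F) := by
  funext j
  by_cases hj : j = Fin.last d
  · subst hj
    simp
  · simp [Function.update_of_ne hj, Pi.single_eq_of_ne hj]

/-- **Period `e_last` = cylinder over the last coordinate**: if `e_last` is a period vector of
`B ⊆ F^{d+1}` (characteristic zero) then membership in the closure `Z(I(B))` does not depend on the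
last coordinate. [folklore] -/
theorem mem_zeroLocus_vanishingIdeal_update_last_iff {F : Type*} [Field F] [CharZero F] {d : ℕ}
    {B : Set (Fin (d + 1) → F)} (h : IsPeriodVec F B (Pi.single (Fin.last d) 1))
    (x : Fin (d + 1) → F) (t : F) :
    Function.update x (Fin.last d) t ∈ zeroLocus F (vanishingIdeal F B) ↔
      x ∈ zeroLocus F (vanishingIdeal F B) := by
  have key : ∀ (y : Fin (d + 1) → F) (s : F), y ∈ zeroLocus F (vanishingIdeal F B) →
      Function.update y (Fin.last d) s ∈ zeroLocus F (vanishingIdeal F B) := by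
    intro y s hy
    have h' := (isPeriodVec_iff_line B _).1 h (s - y (Fin.last d)) y hy
    rw [intCast_single_last] at h'
    rwa [update_last_eq_add_smul]
  constructor
  · intro hx
    have := key _ (x (Fin.last d)) hx
    rwa [Function.update_idem, Function.update_eq_self] at this
  · exact key x t

/-- A period `k · v`, `k ≠ 0`, gives the period `v` (tree: `period_of_period_zsmul`). [folklore] -/
theorem IsPeriodVec.of_zsmul {F : Type*} [Field F] [CharZero F] {n : ℕ} {B : Set (Fin n → F)}
    {v : Fin n → ℤ} {k : ℤ} (hk : k ≠ 0) (h : IsPeriodVec F B (k • v)) : IsPeriodVec F B v :=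
  period_of_period_zsmul hk h

/-- **Reduction of the periodic sub-cell to the period `e_last`.**  `ECCellPeriodic d ↔
ECCellPeriodicStd d`: given `W` with period `v = g · v'` (`v'` primitive, `EACLatticeLemmas`),
`v'` is itself a period (`period_of_period_zsmul`); choose an inverse pair `U, V` with
`U v' = e_last`; the closure `W^U` of `Φ_U(W ∩ Gⁿ)` satisfies every binder of the cell
(`cell_hypotheses_latticeClosure`), its base `U · B` has the period `U v' = e_last`, and `W^U`
meets `Γ_exp` iff `W` does. [cite: MantovaMasser2023] -/
theorem ecCellPeriodic_iff_std {d : ℕ} : ECCellPeriodic d ↔ ECCellPeriodicStd d := by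
  constructor
  · intro h W hW hne hrot hadd hmul hdim hapd hstd
    exact h W hW hne hrot hadd hmul hdim hapd ⟨_, single_last_ne_zero d, hstd⟩
  · intro hstd W hW hne hrot hadd hmul hdim hapd hper
    obtain ⟨v, hv0, hv⟩ := hper
    obtain ⟨g, v', hg, rfl, hv'⟩ := exists_eq_smul_primitive hv0
    have hv'per : IsPeriodVec ℂ (projAdd '' (W ∩ torusLocus ℂ (d + 1))) v' :=
      IsPeriodVec.of_zsmul hg hv
    classical
    obtain ⟨U, V, hUV, hVU, hUv', -⟩ := exists_unimodular_pair_of_primitive hv' (Fin.last d)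
    obtain ⟨hW', hne', hrot', hadd', hmul', hdim', hapd', hiff⟩ :=
      cell_hypotheses_latticeClosure hUV hVU hW hne hrot hadd hmul hdim hapd
    refine hiff.1 (hstd _ hW' hne' hrot' hadd' hmul' hdim' hapd' ?_)
    rw [projAdd_image_latticeClosure_inter hUV hVU hW.1, ← hUv']
    exact isPeriodVec_image_intLinMap hUV hVU hv'per

/-- Hence the next open cell splits as: aperiodic sub-cell and periodic sub-cell with period
`e_last` (cylinder base).
[cite: MantovaMasser2023] -/
theorem ecCell_succ_iff_aperiodic_and_std {d : ℕ} :
    ECCell (d + 1) d ↔ ECCellAperiodic d ∧ ECCellPeriodicStd d := by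
  rw [← ecCellPeriodic_iff_std]
  exact ecCell_succ_iff d

/-- In particular for `EC(3,2)`. [cite: MantovaMasser2023] -/
theorem ecCell_three_two_iff_aperiodic_and_std :
    ECCell 3 2 ↔ ECCellAperiodic 2 ∧ ECCellPeriodicStd 2 :=
  ecCell_succ_iff_aperiodic_and_std

section FibrationSplit

/-! ### Splitting the normalised periodic sub-cell by the projection forgetting `x_last`

In normal form the base is a cylinder over the last coordinate.  Let `Δ_d = diag(1,…,1,0)`; by
rotundity and `dim [Δ_d](W ∩ Gⁿ) ≤ dim W` one has `d ≤ dim [Δ_d](W ∩ Gⁿ) ≤ d + 1`, and the two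
values are different problems (cell documentation, HANDOFF O22): `= d` (FIBRED: the generic fibres
of `W → [Δ_d]W` are curves in `ℂ × ℂˣ`, where the case `n = 1` applies, and the difficulty is an
exponential point of `[Δ_d]W` in general position — for `d = 2` this is the Zariski-density question
for unprojected exponential points over curve bases which Mantova–Masser 2024 leave open, §1
"Further remarks") and `= d + 1` (CO-DOMINANT: `[Δ_d]W` is all of `cl C' × (ℂˣ)^{d} × {(0,1)}`,
generic fibres are finite, and the difficulty is a one-variable iterated-exponential zero problem).
Typed here: the matrix, its rank, the two bounds and the equivalence
`ECCellPeriodicStd d ↔ ECCellPeriodicStdFib d ∧ ECCellPeriodicStdDom d`.  Both halves OPEN. -/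

/-- `Δ_d = diag(1,…,1,0) ∈ M_{d+1}(ℤ)`: the coordinate projection forgetting the last coordinate
(additively `x ↦ (x₀,…,x_{d-1},0)`, multiplicatively `y ↦ (y₀,…,y_{d-1},1)`). [folklore] -/
def dropLastMat (d : ℕ) : Matrix (Fin (d + 1)) (Fin (d + 1)) ℤ :=
  Matrix.diagonal fun j => if j = Fin.last d then 0 else 1

/-- `rank_ℚ Δ_d = d`. [folklore] -/
theorem rank_dropLastMat (d : ℕ) : ((dropLastMat d).map (Int.cast : ℤ → ℚ)).rank = d := by
  classical
  have hmap : (dropLastMat d).map (Int.cast : ℤ → ℚ) =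
      Matrix.diagonal fun j : Fin (d + 1) => if j = Fin.last d then (0 : ℚ) else 1 := by
    rw [dropLastMat, Matrix.diagonal_map (Int.cast_zero)]
    congr 1
    funext j
    split_ifs <;> simp
  rw [hmap, Matrix.rank_diagonal, Fintype.card_subtype]
  have hfilter : (Finset.univ.filter fun j : Fin (d + 1) =>
      (if j = Fin.last d then (0 : ℚ) else 1) ≠ 0) = Finset.univ.erase (Fin.last d) := by
    ext j
    simp only [Finset.mem_filter, Finset.mem_univ, true_and, Finset.mem_erase, and_true]
    split_ifs with h <;> simp [h]
  rw [hfilter, Finset.card_erase_of_mem (Finset.mem_univ _), Finset.card_univ, Fintype.card_fin]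
  simp

variable {d : ℕ}

/-- `d ≤ dim [Δ_d](W ∩ Gⁿ)` for rotund `W ∩ Gⁿ`. [folklore] -/
theorem le_zariskiDim_image_dropLastMat {W : Set (Fin (d + 1) ⊕ Fin (d + 1) → ℂ)}
    (hrot : IsRotund ℂ (d + 1) (W ∩ torusLocus ℂ (d + 1))) :
    (d : WithBot ℕ∞) ≤
      zariskiDim ℂ (matrixAct (dropLastMat d) '' (W ∩ torusLocus ℂ (d + 1))) := by
  have h := hrot (dropLastMat d)
  rw [rank_dropLastMat] at h
  exact h

/-- `dim [Δ_d](W ∩ Gⁿ) ≤ dim W` (tree: `zariskiDim_image_matrixAct_le`, via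
`zariskiDim_latticeImage_le`). [folklore] -/
theorem zariskiDim_image_dropLastMat_le {W : Set (Fin (d + 1) ⊕ Fin (d + 1) → ℂ)}
    (hW : IsIrreducibleClosed ℂ W) (hne : (W ∩ torusLocus ℂ (d + 1)).Nonempty) :
    zariskiDim ℂ (matrixAct (dropLastMat d) '' (W ∩ torusLocus ℂ (d + 1))) ≤ zariskiDim ℂ W := by
  rw [← latticeImage_eq_image_matrixAct]
  exact zariskiDim_latticeImage_le (dropLastMat d) hW hne

/-- From `d ≤ x ≤ d + 1` in `WithBot ℕ∞`: `x = d` or `x = d + 1`. [folklore] -/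
theorem eq_or_eq_succ_of_le_of_le_succ {x : WithBot ℕ∞} (h1 : (d : WithBot ℕ∞) ≤ x)
    (h2 : x ≤ ((d + 1 : ℕ) : WithBot ℕ∞)) : x = d ∨ x = ((d + 1 : ℕ) : WithBot ℕ∞) := by
  induction x using WithBot.recBotCoe with
  | bot =>
    exfalso
    have : ((d : ℕ∞) : WithBot ℕ∞) ≤ ⊥ := h1
    exact WithBot.not_coe_le_bot _ this
  | coe y =>
    induction y using ENat.recTopCoe with
    | top =>
      exfalso
      have hlt : (((d + 1 : ℕ) : ℕ∞) : WithBot ℕ∞) < ((⊤ : ℕ∞) : WithBot ℕ∞) :=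
        WithBot.coe_lt_coe.mpr (ENat.coe_lt_top _)
      exact not_le.mpr hlt h2
    | coe k =>
      have h1' : ((d : ℕ∞) : WithBot ℕ∞) ≤ ((k : ℕ∞) : WithBot ℕ∞) := h1
      have h2' : ((k : ℕ∞) : WithBot ℕ∞) ≤ (((d + 1 : ℕ) : ℕ∞) : WithBot ℕ∞) := h2
      have h1'' : d ≤ k := by exact_mod_cast h1'
      have h2'' : k ≤ d + 1 := by exact_mod_cast h2'
      rcases Nat.eq_or_lt_of_le h2'' with h | h
      · right
        subst h
        rfl
      · left
        obtain rfl : k = d := by omega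
        rfl

/-- In the normalised periodic sub-cell, `dim [Δ_d](W ∩ Gⁿ) ∈ {d, d + 1}`. [folklore] -/
theorem zariskiDim_image_dropLastMat_eq_or {W : Set (Fin (d + 1) ⊕ Fin (d + 1) → ℂ)}
    (hW : IsIrreducibleClosed ℂ W) (hne : (W ∩ torusLocus ℂ (d + 1)).Nonempty)
    (hrot : IsRotund ℂ (d + 1) (W ∩ torusLocus ℂ (d + 1))) (hdim : zariskiDim ℂ W = (d + 1 : ℕ)) :
    zariskiDim ℂ (matrixAct (dropLastMat d) '' (W ∩ torusLocus ℂ (d + 1))) = d ∨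
      zariskiDim ℂ (matrixAct (dropLastMat d) '' (W ∩ torusLocus ℂ (d + 1))) = (d + 1 : ℕ) := by
  refine eq_or_eq_succ_of_le_of_le_succ (le_zariskiDim_image_dropLastMat hrot) ?_
  rw [← hdim]
  exact zariskiDim_image_dropLastMat_le hW hne

/-- **Normalised periodic sub-cell, FIBRED case**: the binders of `ECCellPeriodicStd d` plus
`dim [Δ_d](W ∩ Gⁿ) = d` (generic fibres of `W → [Δ_d]W` are curves).  OPEN; for `d = 2` its
difficulty is Mantova–Masser's open Zariski-density question for unprojected exponential points
over curve bases (2024, §1 Further remarks).  Never asserted. [cite: MantovaMasser2023] -/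
def ECCellPeriodicStdFib (d : ℕ) : Prop :=
  ∀ (W : Set (Fin (d + 1) ⊕ Fin (d + 1) → ℂ)), IsIrreducibleClosed ℂ W →
    (W ∩ torusLocus ℂ (d + 1)).Nonempty → IsRotund ℂ (d + 1) (W ∩ torusLocus ℂ (d + 1)) →
    IsAddFree ℂ (d + 1) (W ∩ torusLocus ℂ (d + 1)) → IsMulFree ℂ (d + 1) (W ∩ torusLocus ℂ (d + 1)) →
    zariskiDim ℂ W = (d + 1 : ℕ) → addProjDim ℂ (d + 1) W = d →
    IsPeriodVec ℂ (projAdd '' (W ∩ torusLocus ℂ (d + 1))) (Pi.single (Fin.last d) 1) →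
    zariskiDim ℂ (matrixAct (dropLastMat d) '' (W ∩ torusLocus ℂ (d + 1))) = d →
    (W ∩ expGraph ℂ (d + 1)).Nonempty

/-- **Normalised periodic sub-cell, CO-DOMINANT case**: the binders of `ECCellPeriodicStd d` plus
`dim [Δ_d](W ∩ Gⁿ) = d + 1` (generic fibres of `W → [Δ_d]W` are finite).  OPEN; never asserted.
[cite: MantovaMasser2023] -/
def ECCellPeriodicStdDom (d : ℕ) : Prop :=
  ∀ (W : Set (Fin (d + 1) ⊕ Fin (d + 1) → ℂ)), IsIrreducibleClosed ℂ W →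
    (W ∩ torusLocus ℂ (d + 1)).Nonempty → IsRotund ℂ (d + 1) (W ∩ torusLocus ℂ (d + 1)) →
    IsAddFree ℂ (d + 1) (W ∩ torusLocus ℂ (d + 1)) → IsMulFree ℂ (d + 1) (W ∩ torusLocus ℂ (d + 1)) →
    zariskiDim ℂ W = (d + 1 : ℕ) → addProjDim ℂ (d + 1) W = d →
    IsPeriodVec ℂ (projAdd '' (W ∩ torusLocus ℂ (d + 1))) (Pi.single (Fin.last d) 1) →
    zariskiDim ℂ (matrixAct (dropLastMat d) '' (W ∩ torusLocus ℂ (d + 1))) = (d + 1 : ℕ) →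
    (W ∩ expGraph ℂ (d + 1)).Nonempty

/-- **The normalised periodic sub-cell splits by the fibre dimension of `[Δ_d]`.**
`ECCellPeriodicStd d ↔ ECCellPeriodicStdFib d ∧ ECCellPeriodicStdDom d`
(`zariskiDim_image_dropLastMat_eq_or`). [cite: MantovaMasser2023] -/
theorem ecCellPeriodicStd_iff_fib_and_dom : ECCellPeriodicStd d ↔
    ECCellPeriodicStdFib d ∧ ECCellPeriodicStdDom d := by
  constructor
  · intro h
    exact ⟨fun W hW hne hrot hadd hmul hdim hapd hper _ => h W hW hne hrot hadd hmul hdim hapd hper,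
      fun W hW hne hrot hadd hmul hdim hapd hper _ => h W hW hne hrot hadd hmul hdim hapd hper⟩
  · rintro ⟨hfib, hdom⟩ W hW hne hrot hadd hmul hdim hapd hper
    rcases zariskiDim_image_dropLastMat_eq_or hW hne hrot hdim with h | h
    · exact hfib W hW hne hrot hadd hmul hdim hapd hper h
    · exact hdom W hW hne hrot hadd hmul hdim hapd hper h

/-- Hence `EC(d+1, d)` splits into three typed open pieces: aperiodic, periodic-fibred,
periodic-co-dominant. [cite: MantovaMasser2023] -/
theorem ecCell_succ_iff_three : ECCell (d + 1) d ↔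
    ECCellAperiodic d ∧ ECCellPeriodicStdFib d ∧ ECCellPeriodicStdDom d := by
  rw [ecCell_succ_iff_aperiodic_and_std, ecCellPeriodicStd_iff_fib_and_dom]

/-- In particular for the next open cell `EC(3,2)`. [cite: MantovaMasser2023] -/
theorem ecCell_three_two_iff_three : ECCell 3 2 ↔
    ECCellAperiodic 2 ∧ ECCellPeriodicStdFib 2 ∧ ECCellPeriodicStdDom 2 :=
  ecCell_succ_iff_three

end FibrationSplit

end Literature.ModelTheory.Zilber
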